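import Mathlib
import HarnessLib
import Summits.NavierStokesRegularity.NavierStokesRegularity.Theorems.QuarterLogPincerEmberCensusDefs
import Summits.NavierStokesRegularity.NavierStokesRegularity.Theorems.QuarterLogPincerEmberCensusKernel
import Summits.NavierStokesRegularity.NavierStokesRegularity.Theorems.QuarterLogPincerEmberCensusHotWitnessFar
import Summits.NavierStokesRegularity.NavierStokesRegularity.Theorems.QuarterLogPincerBeadCensusKernel

/-!
# Route `QuarterLogPincer`, crux `TypeIQuantSubcubicExp` (stmt-NavierStokesRegularity-24077), line `ember_census` —
# §E.K2 BY NAME: E1a closed by the tree theorem, E1 = E1a ⊕ E1b, E2 ⇒ E2♭, and the EDGE E1 + E2♭ ⇒ G1♯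

VERBATIM port (bodies byte-identical up to the unfolding of `E3`) of the sorry-free part of §E of
`Cruxes/TypeIQuantSubcubicExp/Lines/ember_census.lean` v1.2 (ns-idea-7 g13; idea-crit-4 PASS 2026-08-29T08:26Z) over the landed objects
(`…EmberCensusDefs` with its v1.2 append `HotWitness` / `HotWitnessFar` / `HotWitnessNear` / `TerminalEmberM`, `…BeadCensusDefs`):
★ `stub_hotWitnessFar : HotWitnessFar` — E1a BY NAME, definitionally the tree theorem `EmberCensus.hotWitness_far` (p704006);
`hotWitness_of_far_of_near : HotWitnessFar → HotWitnessNear → HotWitness` (recombination, `Γ := max Γ₀ Γ₁`);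
`terminalEmberM_of_terminalEmber : TerminalEmber → TerminalEmberM` (E2 ⇒ E2♭); the line's EDGE
`flarePersistence_of_hotWitness_of_terminalEmberM : HotWitness → TerminalEmberM → FlarePersistence` (shell geometry) and its v1.1 corollary
`flarePersistence_of_hotWitness_of_terminalEmber`.  NOT ported: the stubs E1b `stub_hotWitnessNear`, E2♭ `stub_terminalEmberM`, G2, and
their pluggings.  HONEST FRAME: implications between Props about HYPOTHETICAL Type-I classical solutions; E1b, E2♭, G2 OPEN; nothing here
bears on G1♯'s truth, the crux, W7 or Navier–Stokes regularity (OPEN / not proved).  pub-ns-dss typer (g38),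
`--supports stmt-NavierStokesRegularity-24077`; bodies by ns-idea-7 (g12–g13).
-/

set_option linter.dupNamespace false

namespace Summit.NavierStokesRegularity.NavierStokesRegularity.Cruxes.TypeIQuantSubcubicExp.EmberCensus

noncomputable section

open MeasureTheory Set Function Filter Topology Metric
open scoped ENNReal NNReal Classical
open Literature.Analysis Literature.Analysis.FluidPDE
open Summit.NavierStokesRegularity.NavierStokesRegularity.Cruxes.TypeIQuantSubcubicExp.BeadCensus
  (levelScale levelShell GoodLevel FlarePersistenceAt FlarePersistence sqrt_levelScale)

/-- E1a is the tree's theorem `EmberCensus.hotWitness_far` (no sorry; `levelScale a t₁ (k+1)` unfolds to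
`t₁ * Real.exp (-2 * a * ↑(k + 1))` by `rfl`). -/
theorem stub_hotWitnessFar : HotWitnessFar := fun μ M hμ hM => hotWitness_far μ M hμ hM

/-- **E1 = E1a ⊕ E1b (kernel-checked; v1.2).**  `Γ := max Γ₀ Γ₁`; the clock at `t₁` is either far (`r² < T'−t₁`:
E1a says the annulus IS quiet — contradiction, nothing to find) or near (`T'−t₁ ≤ r²`: E1b's witness). -/
theorem hotWitness_of_far_of_near (hfar : HotWitnessFar) (hnear : HotWitnessNear) : HotWitness := by
  intro μ M ε₀ hμ hM hε₀
  obtain ⟨ε, hε, hεle, Γ₁, hΓ₁, hN⟩ := hnear μ M ε₀ hμ hM hε₀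
  obtain ⟨Γ₀, hΓ₀, hF⟩ := hfar μ M hμ hM
  refine ⟨ε, max Γ₀ Γ₁, hε, hεle, le_trans hΓ₁ (le_max_right _ _), ?_⟩
  intro T τ u p hframe hτ hrate a t₁ x₀ k R ht₁ hroom hR₁ hR₂ hviol
  by_cases hle : T + τ - t₁ ≤ (max Γ₀ Γ₁ * Real.sqrt (levelScale a t₁ (k + 1))) ^ 2
  · exact hN (max Γ₀ Γ₁) (le_max_right _ _) T τ u p hframe hτ hrate a t₁ x₀ k R ht₁ hroom hR₁ hR₂ hle hviol
  · exact absurd (hF (max Γ₀ Γ₁) (le_max_left _ _) T τ u p hframe hτ hrate a t₁ x₀ k R ht₁ hroom hR₁ hR₂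
      (lt_of_not_ge hle)) hviol

/-- E2 ⇒ E2♭ (the sister lines `silencing_cost` / `smooth_silence` conclude E2 `TerminalEmber` BY NAME and plug in here). -/
theorem terminalEmberM_of_terminalEmber (h : TerminalEmber) : TerminalEmberM := by
  obtain ⟨ε₀, hε₀, hE⟩ := h
  intro M hM
  exact ⟨ε₀, hε₀, fun ε hε hεle => hE ε M hε hεle hM⟩

/-- **THE LINE'S EDGE (kernel-checked): E1 + E2♭ ⇒ G1♯ `BeadCensus.FlarePersistence`.**  For a bad level `k+1` the
candidate annulus `R := 4M√s + (1+27K)Γ√s` is violated; E1 gives a hot witness within `r = Γ√s` of it in the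
last `4r²` of time (clock `≤ 3r`); K1 its terminal descendant (drift `≤ 24Kr`); E2♭ an ember of radius `≤ 3Kr`;
the ember ball lies in `levelShell (k+1)` because `a ≥ a₀ := M^{10μ}(4M+(1+27K)Γ) + (1+27K)Γ + (4+5Λ)Γ²`
makes `e^{a} > a ≥` the outer coefficient and `(4+5Λ)Γ²e^{-2a} ≤ 1` the room. -/
theorem flarePersistence_of_hotWitness_of_terminalEmberM (h1 : HotWitness) (h2 : TerminalEmberM) :
    FlarePersistence := by
  intro μ M hμ hM
  obtain ⟨ε₀, hε₀, hE0⟩ := h2 M hM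
  obtain ⟨ε, Γ, hε, hεle, hΓ, hW⟩ := h1 μ M ε₀ hμ hM hε₀
  obtain ⟨K, c, Λ, hK, hc, hΛ, hE⟩ := hE0 ε hε hεle
  have hΛ0 : 0 ≤ Λ := by linarith
  have hM0 : 0 < M := by linarith
  have hΘ0 : 0 ≤ M ^ (10 * μ) := Real.rpow_nonneg hM0.le _
  have hK0 : 0 ≤ K := by linarith
  have hΓ0 : 0 ≤ Γ := by linarith
  have h27 : 0 ≤ (1 + 27 * K) * Γ := mul_nonneg (by linarith) hΓ0
  have hin : 0 ≤ 4 * M + (1 + 27 * K) * Γ := by linarith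
  have hΘsum : 0 ≤ M ^ (10 * μ) * (4 * M + (1 + 27 * K) * Γ) := mul_nonneg hΘ0 hin
  have hΓ2 : 0 ≤ (4 + 5 * Λ) * Γ ^ 2 := mul_nonneg (by linarith) (sq_nonneg Γ)
  refine ⟨M ^ (10 * μ) * (4 * M + (1 + 27 * K) * Γ) + (1 + 27 * K) * Γ + (4 + 5 * Λ) * Γ ^ 2,
    by linarith, fun a ha => ⟨c, hc, ?_⟩⟩
  intro T τ A t₁ x₀ u p k hframe hτ htypeI hL3 hA ht₁ hbad
  -- the level scale `s`, its root `q`, the witness radius `r = Γ q`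
  set s : ℝ := levelScale a t₁ (k + 1) with hs_def
  have hs_pos : 0 < s := mul_pos ht₁.1 (Real.exp_pos _)
  set q : ℝ := Real.sqrt s with hq_def
  have hq0 : 0 < q := Real.sqrt_pos.2 hs_pos
  set r : ℝ := Γ * q with hr_def
  have hr0 : 0 ≤ r := mul_nonneg hΓ0 hq0.le
  have hr2 : r ^ 2 = Γ ^ 2 * s := by rw [hr_def, mul_pow, hq_def, Real.sq_sqrt hs_pos.le]
  -- `e^a` dominates `a ≥ a₀ ≥ 0`
  have ha0 : 0 ≤ a := by linarith
  have hexp1 : a + 1 ≤ Real.exp a := Real.add_one_le_exp a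
  have hcoef : M ^ (10 * μ) * (4 * M + (1 + 27 * K) * Γ) + (1 + 27 * K) * Γ ≤ a := by linarith
  have h9 : (4 + 5 * Λ) * Γ ^ 2 ≤ Real.exp a := by linarith
  -- room: `(4 + 5Λ) r² ≤ t₁` (hence `9 r² ≤ t₁` for E1 and `Λ σ² ≤ t` for E2)
  have hroom : (4 + 5 * Λ) * r ^ 2 ≤ t₁ := by
    have hs_le : s ≤ t₁ * Real.exp (-a) := by
      have e : s = t₁ * Real.exp (-2 * a * ((k : ℝ) + 1)) := by
        simp only [hs_def, levelScale, Nat.cast_add, Nat.cast_one]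
      rw [e]
      refine mul_le_mul_of_nonneg_left (Real.exp_le_exp.2 ?_) ht₁.1.le
      nlinarith [mul_nonneg ha0 (Nat.cast_nonneg k : (0 : ℝ) ≤ k)]
    have hea : Real.exp a * Real.exp (-a) = 1 := by rw [← Real.exp_add]; simp
    calc (4 + 5 * Λ) * r ^ 2 = (4 + 5 * Λ) * Γ ^ 2 * s := by rw [hr2]; ring
      _ ≤ (4 + 5 * Λ) * Γ ^ 2 * (t₁ * Real.exp (-a)) := mul_le_mul_of_nonneg_left hs_le hΓ2
      _ = ((4 + 5 * Λ) * Γ ^ 2) * Real.exp (-a) * t₁ := by ring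
      _ ≤ Real.exp a * Real.exp (-a) * t₁ :=
          mul_le_mul_of_nonneg_right (mul_le_mul_of_nonneg_right h9 (Real.exp_nonneg _)) ht₁.1.le
      _ = t₁ := by rw [hea, one_mul]
  -- the candidate annulus `R := 4Mq + (1+27K) r`
  set R : ℝ := 4 * M * q + (1 + 27 * K) * r with hR_def
  have h27r : 0 ≤ (1 + 27 * K) * r := mul_nonneg (by linarith) hr0
  have hc1 : 4 * M * q ≤ R := by linarith
  have hc2 : M ^ (10 * μ) * R ≤ Real.exp a * q := by
    have e : M ^ (10 * μ) * R = (M ^ (10 * μ) * (4 * M + (1 + 27 * K) * Γ)) * q := by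
      rw [hR_def, hr_def]; ring
    rw [e]
    exact mul_le_mul_of_nonneg_right (by linarith) hq0.le
  -- the level is bad: this annulus is violated
  have hviol : ¬ ∀ t ∈ Icc (t₁ - s / 32) t₁, ∀ x : (EuclideanSpace ℝ (Fin 3)), R < ‖x - x₀‖ → ‖x - x₀‖ < M ^ (10 * μ) * R →
      ∀ j : ℕ, j ≤ 2 → ‖iteratedFDeriv ℝ j (u t) x‖ ≤ M ^ (-(3 * μ)) * s ^ (-(((j : ℝ) + 1) / 2)) :=
    fun hq => hbad ⟨R, hc1, hc2, hq⟩
  -- E1: a hot witness near the annulus, late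
  have hroom9 : 9 * r ^ 2 ≤ t₁ := by
    linarith [mul_nonneg (sub_nonneg.2 hΛ) (sq_nonneg r)]
  obtain ⟨y, t, hhot, htle, htlate, hclock, hyl, hyu⟩ :=
    hW T τ u p hframe hτ htypeI a t₁ x₀ k R ht₁ hroom9 hc1 hc2 hviol
  simp only [← hs_def, ← hq_def, ← hr_def] at htlate hclock hyl hyu
  -- K1: its terminal descendant
  have ht₁T : t₁ < T + τ := by linarith [ht₁.2]
  obtain ⟨y', t', hhot', hterm', htt', ht'le, hdist⟩ :=
    exists_terminal_descendant (K := K) hK0 ht₁T hhot htle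
  -- E2: the ember (room: `Λ(T'−t') ≤ Λ(T'−t) ≤ 5Λr² ≤ t₁ − 4r² ≤ t ≤ t'`)
  have hroomE : Λ * (T + τ - t') ≤ t' := by
    have h1 : Λ * (T + τ - t') ≤ Λ * (T + τ - t) := mul_le_mul_of_nonneg_left (by linarith) hΛ0
    have h2 : Λ * (T + τ - t) ≤ Λ * (5 * r ^ 2) := mul_le_mul_of_nonneg_left hclock hΛ0
    linarith
  have hember := hE T τ u p hframe hτ htypeI t₁ y' t' ht₁ ht'le hroomE hhot' hterm'
  -- the ember ball lies inside the level shell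
  have hσ : Real.sqrt (T + τ - t) ≤ 3 * r := by
    have e9 : (3 * r) ^ 2 = 9 * r ^ 2 := by ring
    calc Real.sqrt (T + τ - t) ≤ Real.sqrt ((3 * r) ^ 2) :=
          Real.sqrt_le_sqrt (by rw [e9]; linarith [sq_nonneg r])
      _ = 3 * r := Real.sqrt_sq (by positivity)
  have hσ' : Real.sqrt (T + τ - t') ≤ Real.sqrt (T + τ - t) := Real.sqrt_le_sqrt (by linarith)
  have hd24 : ‖y' - y‖ ≤ 24 * K * r := by
    calc ‖y' - y‖ ≤ 8 * K * (Real.sqrt (T + τ - t) - Real.sqrt (T + τ - t')) := hdist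
      _ ≤ 8 * K * (3 * r) := by
          refine mul_le_mul_of_nonneg_left ?_ (by positivity)
          linarith [Real.sqrt_nonneg (T + τ - t')]
      _ = 24 * K * r := by ring
  have hup : M ^ (10 * μ) * R + r + 24 * K * r + 3 * K * r < Real.exp a * q := by
    have e : M ^ (10 * μ) * R + r + 24 * K * r + 3 * K * r =
        (M ^ (10 * μ) * (4 * M + (1 + 27 * K) * Γ) + (1 + 27 * K) * Γ) * q := by
      rw [hR_def, hr_def]; ring
    rw [e]
    exact mul_lt_mul_of_pos_right (by linarith) hq0
  have hsub : ball y' (K * Real.sqrt (T + τ - t')) ⊆ levelShell M a t₁ x₀ (k + 1) := by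
    intro x hx
    rw [mem_ball, dist_eq_norm] at hx
    have hx3 : ‖x - y'‖ < 3 * K * r := by
      calc ‖x - y'‖ < K * Real.sqrt (T + τ - t') := hx
        _ ≤ K * (3 * r) := mul_le_mul_of_nonneg_left (hσ'.trans hσ) hK0
        _ = 3 * K * r := by ring
    have htri₁ : ‖y - x₀‖ ≤ ‖y' - y‖ + ‖x - y'‖ + ‖x - x₀‖ := by
      calc ‖y - x₀‖ = ‖(y - y') + (y' - x) + (x - x₀)‖ := by congr 1; abel
        _ ≤ ‖y - y'‖ + ‖y' - x‖ + ‖x - x₀‖ := norm_add₃_le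
        _ = ‖y' - y‖ + ‖x - y'‖ + ‖x - x₀‖ := by rw [norm_sub_rev y y', norm_sub_rev y' x]
    have htri₂ : ‖x - x₀‖ ≤ ‖x - y'‖ + ‖y' - y‖ + ‖y - x₀‖ := by
      calc ‖x - x₀‖ = ‖(x - y') + (y' - y) + (y - x₀)‖ := by congr 1; abel
        _ ≤ ‖x - y'‖ + ‖y' - y‖ + ‖y - x₀‖ := norm_add₃_le
    show 4 * M * q < ‖x - x₀‖ ∧ ‖x - x₀‖ < Real.exp a * q
    constructor
    · linarith
    · linarith
  exact hember.trans (lintegral_mono_set hsub)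

/-- The v1.1 edge by name: E1 + E2 ⇒ G1♯. -/
theorem flarePersistence_of_hotWitness_of_terminalEmber (h1 : HotWitness) (h2 : TerminalEmber) :
    FlarePersistence :=
  flarePersistence_of_hotWitness_of_terminalEmberM h1 (terminalEmberM_of_terminalEmber h2)

end

end Summit.NavierStokesRegularity.NavierStokesRegularity.Cruxes.TypeIQuantSubcubicExp.EmberCensus
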